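import Summits.Ventures.CertifiedManyBodySolver.Downfold.EmeryFermiSurfaceShape
import HarnessLib

/-!
# The antibonding band of the σ three-band (Emery) model at general k: the largest root of the
# characteristic cubic, with rational enclosure criteria

Venture CertifiedManyBodySolver, cell `pub/hubbard-downfold` (stage S1, HUMAN RULINGS D-0096/D-0098),
seat hubbard-downfold-mod-4 (technique B); namespace `Summit.Ventures.CertifiedManyBodySolver.Downfold.Emery`.
Everything here is PROVED. WHAT THIS IS NOT: a statement about any material; no number lives here.

`EmeryBlochBand` / `EmeryBandReductionAcrossCu` give the antibonding energy in CLOSED FORM only at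
Γ, X, M, S (2 × 2 blocks); `EmeryFermiSurfaceShape` gives the secular function `charCubic(x, y, ε)` at
every `x = sin²(kx/2)`, `y = sin²(ky/2)`. Here the antibonding band is defined at EVERY k:

* §1 `topRoot a b d` — the largest real root of the monic cubic `ε³ + aε² + bε + d` (`sSup` of the
  root set: nonempty by the intermediate value theorem between `∓(1 + |a| + |b| + |d|)`, closed,
  bounded); RATIONAL ENCLOSURE CRITERIA: `p(ν) ≤ 0 ⇒ ν ≤ topRoot` (`le_topRoot_of_nonpos`) and
  `p(μ) > 0 ∧ 3μ² + 2aμ + b ≥ 0 ∧ 3μ + a ≥ 0 ⇒ topRoot < μ` (`topRoot_lt_of_taylor`, exact Taylor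
  identity) — sign checks of rational numbers suffice to pin a band energy.
* §2 `abBand Δ t_pd t_pp t_pp′ x y` — THE ANTIBONDING BAND: the top root of `charCubic`; it is a band
  energy (`charCubic_abBand`, `det_bloch4_abBand`) and dominates every band energy at that k
  (`le_abBand_of_det_eq_zero`); enclosure corollaries `le_abBand_of_charCubic_nonpos`,
  `abBand_lt_of_taylor`; it agrees with the closed forms at Γ and X (`abBand_Gamma`, `abBand_X`) and on
  the whole Γ–X axis (`abBand_axis`: `ε_AB(x, 0) = (−Δ + √(Δ² + 16t_pd²x))/2`, independent of `t_pp`).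

Used by `EmeryOneBandMisfitFloor` (certified floors on the one-band-form misfit).
Sources: three-band model [HybertsenSchluterChristensen1989, Eq. (1)]; the mathematics (largest real root
of a cubic via the intermediate value theorem and a Cauchy bound) is elementary.
-/

noncomputable section

namespace Summit.Ventures.CertifiedManyBodySolver.Downfold.Emery

open Real

/-! ## §1 The largest real root of a monic cubic and its rational enclosure criteria -/

/-- The monic cubic `p(ε) = ε³ + aε² + bε + d`. [folklore] -/
def monicCubic (a b d ε : ℝ) : ℝ := ε ^ 3 + a * ε ^ 2 + b * ε + d

/-- Continuity of the monic cubic in `ε`. [folklore] -/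
theorem continuous_monicCubic (a b d : ℝ) : Continuous fun ε => monicCubic a b d ε := by
  unfold monicCubic
  fun_prop

/-- The Cauchy-type bound `M = 1 + |a| + |b| + |d|`. [folklore] -/
def cubicBound (a b d : ℝ) : ℝ := 1 + |a| + |b| + |d|

/-- `M ≥ 1`. [folklore] -/
theorem one_le_cubicBound (a b d : ℝ) : 1 ≤ cubicBound a b d := by
  unfold cubicBound
  have := abs_nonneg a
  have := abs_nonneg b
  have := abs_nonneg d
  linarith

/-- Beyond the bound the cubic is positive: `ε ≥ M ⇒ p(ε) > 0`. [folklore] -/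
theorem monicCubic_pos_of_ge {a b d ε : ℝ} (h : cubicBound a b d ≤ ε) : 0 < monicCubic a b d ε := by
  unfold cubicBound at h
  unfold monicCubic
  have ha := neg_abs_le a
  have hb := neg_abs_le b
  have hd := neg_abs_le d
  have h0a := abs_nonneg a
  have h0b := abs_nonneg b
  have h0d := abs_nonneg d
  have hε1 : 1 ≤ ε := by linarith
  have hε0 : 0 ≤ ε := by linarith
  have hεsq : ε ≤ ε ^ 2 := by nlinarith
  have h1sq : 1 ≤ ε ^ 2 := le_trans hε1 hεsq
  have h1 : -|a| * ε ^ 2 ≤ a * ε ^ 2 := by nlinarith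
  have h2a : -|b| * ε ≤ b * ε := mul_le_mul_of_nonneg_right hb hε0
  have h2b : |b| * ε ≤ |b| * ε ^ 2 := mul_le_mul_of_nonneg_left hεsq h0b
  have h2 : -|b| * ε ^ 2 ≤ b * ε := by linarith
  have h3a : |d| ≤ |d| * ε ^ 2 := le_mul_of_one_le_right h0d h1sq
  have h3 : -|d| * ε ^ 2 ≤ d := by linarith
  have h4 : ε ^ 2 * (ε - |a| - |b| - |d|) ≥ ε ^ 2 := by nlinarith
  nlinarith

/-- Below minus the bound the cubic is negative: `ε ≤ −M ⇒ p(ε) < 0`. [folklore] -/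
theorem monicCubic_neg_of_le {a b d ε : ℝ} (h : ε ≤ -cubicBound a b d) : monicCubic a b d ε < 0 := by
  unfold cubicBound at h
  unfold monicCubic
  have ha := le_abs_self a
  have hb := neg_abs_le b
  have hd := le_abs_self d
  have h0a := abs_nonneg a
  have h0b := abs_nonneg b
  have h0d := abs_nonneg d
  set s := -ε with hs
  have hε : ε = -s := by rw [hs]; ring
  have hs1 : 1 ≤ s := by linarith
  have hs0 : 0 ≤ s := by linarith
  rw [hε]
  have hssq : s ≤ s ^ 2 := by nlinarith
  have h1sq : 1 ≤ s ^ 2 := le_trans hs1 hssq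
  have h1 : a * (-s) ^ 2 ≤ |a| * s ^ 2 := by nlinarith
  have h2a : b * (-s) ≤ |b| * s := by nlinarith
  have h2b : |b| * s ≤ |b| * s ^ 2 := mul_le_mul_of_nonneg_left hssq h0b
  have h2 : b * (-s) ≤ |b| * s ^ 2 := le_trans h2a h2b
  have h3a : |d| ≤ |d| * s ^ 2 := le_mul_of_one_le_right h0d h1sq
  have h3 : d ≤ |d| * s ^ 2 := le_trans hd h3a
  have h4 : s ^ 2 * (s - |a| - |b| - |d|) ≥ s ^ 2 := by nlinarith
  nlinarith

/-- The real root set of the monic cubic. [folklore] -/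
def cubicRoots (a b d : ℝ) : Set ℝ := {ε | monicCubic a b d ε = 0}

/-- The root set is closed. [folklore] -/
theorem isClosed_cubicRoots (a b d : ℝ) : IsClosed (cubicRoots a b d) :=
  isClosed_eq (continuous_monicCubic a b d) continuous_const

/-- Every root is `< M`. [folklore] -/
theorem lt_cubicBound_of_root {a b d ε : ℝ} (h : monicCubic a b d ε = 0) : ε < cubicBound a b d := by
  by_contra hle
  push Not at hle
  have := monicCubic_pos_of_ge hle
  linarith

/-- The root set is bounded above (by `M`). [folklore] -/
theorem bddAbove_cubicRoots (a b d : ℝ) : BddAbove (cubicRoots a b d) :=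
  ⟨cubicBound a b d, fun _ hε => (lt_cubicBound_of_root hε).le⟩

/-- Intermediate values: if `p(ν) ≤ 0` then there is a root in `[ν, M]` (so in particular `ν < M`).
[folklore] -/
theorem exists_root_ge_of_nonpos {a b d ν : ℝ} (h : monicCubic a b d ν ≤ 0) :
    ∃ r, ν ≤ r ∧ monicCubic a b d r = 0 := by
  have hνM : ν ≤ cubicBound a b d := by
    by_contra hlt
    push Not at hlt
    have := monicCubic_pos_of_ge hlt.le
    linarith
  have hcont : ContinuousOn (fun ε => monicCubic a b d ε) (Set.Icc ν (cubicBound a b d)) :=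
    (continuous_monicCubic a b d).continuousOn
  have hmem : (0 : ℝ) ∈ Set.Icc (monicCubic a b d ν) (monicCubic a b d (cubicBound a b d)) :=
    ⟨h, (monicCubic_pos_of_ge le_rfl).le⟩
  obtain ⟨r, hr, hr0⟩ := intermediate_value_Icc hνM hcont hmem
  exact ⟨r, hr.1, hr0⟩

/-- The root set is nonempty (a real cubic has a real root). [folklore] -/
theorem cubicRoots_nonempty (a b d : ℝ) : (cubicRoots a b d).Nonempty := by
  obtain ⟨r, -, hr⟩ := exists_root_ge_of_nonpos (monicCubic_neg_of_le (le_refl (-cubicBound a b d))).le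
  exact ⟨r, hr⟩

/-- The largest real root of the monic cubic. [folklore] -/
def topRoot (a b d : ℝ) : ℝ := sSup (cubicRoots a b d)

/-- `topRoot` is a root. [folklore] -/
theorem monicCubic_topRoot (a b d : ℝ) : monicCubic a b d (topRoot a b d) = 0 :=
  (isClosed_cubicRoots a b d).csSup_mem (cubicRoots_nonempty a b d) (bddAbove_cubicRoots a b d)

/-- Every root is `≤ topRoot`. [folklore] -/
theorem le_topRoot_of_root {a b d ε : ℝ} (h : monicCubic a b d ε = 0) : ε ≤ topRoot a b d :=
  le_csSup (bddAbove_cubicRoots a b d) h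

/-- LOWER ENCLOSURE CRITERION: `p(ν) ≤ 0 ⇒ ν ≤ topRoot`. [folklore] -/
theorem le_topRoot_of_nonpos {a b d ν : ℝ} (h : monicCubic a b d ν ≤ 0) : ν ≤ topRoot a b d := by
  obtain ⟨r, hνr, hr⟩ := exists_root_ge_of_nonpos h
  exact le_trans hνr (le_topRoot_of_root hr)

/-- Exact Taylor identity of the monic cubic at `μ`. [folklore] -/
theorem monicCubic_taylor (a b d μ ε : ℝ) :
    monicCubic a b d ε = monicCubic a b d μ + (3 * μ ^ 2 + 2 * a * μ + b) * (ε - μ)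
      + (3 * μ + a) * (ε - μ) ^ 2 + (ε - μ) ^ 3 := by
  unfold monicCubic
  ring

/-- UPPER ENCLOSURE CRITERION: `p(μ) > 0`, `p′(μ) = 3μ² + 2aμ + b ≥ 0`, `p″(μ)/2 = 3μ + a ≥ 0` ⇒ the cubic
is positive on `[μ, ∞)`, hence every root, in particular `topRoot`, is `< μ`. [folklore] -/
theorem topRoot_lt_of_taylor {a b d μ : ℝ} (h0 : 0 < monicCubic a b d μ)
    (h1 : 0 ≤ 3 * μ ^ 2 + 2 * a * μ + b) (h2 : 0 ≤ 3 * μ + a) : topRoot a b d < μ := by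
  by_contra hle
  push Not at hle
  have hroot := monicCubic_topRoot a b d
  set r := topRoot a b d
  have hrm : 0 ≤ r - μ := by linarith
  have ht := monicCubic_taylor a b d μ r
  have : 0 < monicCubic a b d r := by
    rw [ht]
    have e1 : 0 ≤ (3 * μ ^ 2 + 2 * a * μ + b) * (r - μ) := mul_nonneg h1 hrm
    have e2 : 0 ≤ (3 * μ + a) * (r - μ) ^ 2 := mul_nonneg h2 (sq_nonneg _)
    have e3 : 0 ≤ (r - μ) ^ 3 := pow_nonneg hrm 3
    linarith
  linarith

/-! ## §2 The antibonding band at general k -/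

/-- Coefficient of `ε²` in `charCubic`: `(Δ + 4t_pp′x) + (Δ + 4t_pp′y)`. [folklore] -/
def cubA (Δ c x y : ℝ) : ℝ := (Δ + 4 * c * x) + (Δ + 4 * c * y)

/-- Coefficient of `ε` in `charCubic`. [folklore] -/
def cubB (Δ tpd tpp c x y : ℝ) : ℝ :=
  (Δ + 4 * c * x) * (Δ + 4 * c * y) - 16 * tpp ^ 2 * x * y - 4 * tpd ^ 2 * (x + y)

/-- Constant coefficient of `charCubic`. [folklore] -/
def cubD (Δ tpd tpp c x y : ℝ) : ℝ :=
  -4 * tpd ^ 2 * x * (Δ + 4 * c * y) - 4 * tpd ^ 2 * y * (Δ + 4 * c * x) - 32 * tpd ^ 2 * tpp * x * y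

/-- `charCubic` is the monic cubic with coefficients `cubA, cubB, cubD`. [folklore] -/
theorem charCubic_eq_monicCubic (Δ tpd tpp c x y ε : ℝ) :
    charCubic Δ tpd tpp c x y ε =
      monicCubic (cubA Δ c x y) (cubB Δ tpd tpp c x y) (cubD Δ tpd tpp c x y) ε := by
  unfold charCubic monicCubic cubA cubB cubD
  ring

/-- THE ANTIBONDING BAND of the σ three-band model at `x = sin²(kx/2)`, `y = sin²(ky/2)`: the largest
root of the characteristic cubic. [cite: HybertsenSchluterChristensen1989, Eq. (1) (three-band d–p model)] -/
def abBand (Δ tpd tpp c x y : ℝ) : ℝ := topRoot (cubA Δ c x y) (cubB Δ tpd tpp c x y) (cubD Δ tpd tpp c x y)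

/-- `abBand` solves the secular equation. [folklore] -/
theorem charCubic_abBand (Δ tpd tpp c x y : ℝ) :
    charCubic Δ tpd tpp c x y (abBand Δ tpd tpp c x y) = 0 := by
  rw [charCubic_eq_monicCubic]
  exact monicCubic_topRoot _ _ _

/-- Every solution of the secular equation at `(x, y)` lies below `abBand`. [folklore] -/
theorem le_abBand_of_charCubic_eq_zero {Δ tpd tpp c x y ε : ℝ} (h : charCubic Δ tpd tpp c x y ε = 0) :
    ε ≤ abBand Δ tpd tpp c x y := by
  rw [charCubic_eq_monicCubic] at h
  exact le_topRoot_of_root h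

/-- `abBand(sx², sy²)` is a band energy of the Bloch matrix `bloch4` at `(sx, sy)`. [folklore] -/
theorem det_bloch4_abBand (Δ tpd tpp c sx sy : ℝ) :
    (bloch4 Δ tpd tpp c sx sy - abBand Δ tpd tpp c (sx ^ 2) (sy ^ 2) • (1 : Matrix (Fin 3) (Fin 3) ℝ)).det
      = 0 := by
  rw [det_bloch4_sub_eq_neg_charCubic, charCubic_abBand, neg_zero]

/-- … and it is the TOP band: every `ε` with `det(bloch4 − ε) = 0` satisfies `ε ≤ abBand(sx², sy²)`.
[folklore] -/
theorem le_abBand_of_det_eq_zero {Δ tpd tpp c sx sy ε : ℝ}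
    (h : (bloch4 Δ tpd tpp c sx sy - ε • (1 : Matrix (Fin 3) (Fin 3) ℝ)).det = 0) :
    ε ≤ abBand Δ tpd tpp c (sx ^ 2) (sy ^ 2) := by
  rw [det_bloch4_sub_eq_neg_charCubic, neg_eq_zero] at h
  exact le_abBand_of_charCubic_eq_zero h

/-- LOWER ENCLOSURE for the band: `charCubic(x, y, ν) ≤ 0 ⇒ ν ≤ ε_AB(x, y)`. [folklore] -/
theorem le_abBand_of_charCubic_nonpos {Δ tpd tpp c x y ν : ℝ} (h : charCubic Δ tpd tpp c x y ν ≤ 0) :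
    ν ≤ abBand Δ tpd tpp c x y := by
  rw [charCubic_eq_monicCubic] at h
  exact le_topRoot_of_nonpos h

/-- UPPER ENCLOSURE for the band: `charCubic(x, y, μ) > 0`, `3μ² + 2·cubA·μ + cubB ≥ 0`, `3μ + cubA ≥ 0`
`⇒ ε_AB(x, y) < μ`. [folklore] -/
theorem abBand_lt_of_taylor {Δ tpd tpp c x y μ : ℝ} (h0 : 0 < charCubic Δ tpd tpp c x y μ)
    (h1 : 0 ≤ 3 * μ ^ 2 + 2 * cubA Δ c x y * μ + cubB Δ tpd tpp c x y)
    (h2 : 0 ≤ 3 * μ + cubA Δ c x y) : abBand Δ tpd tpp c x y < μ := by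
  rw [charCubic_eq_monicCubic] at h0
  exact topRoot_lt_of_taylor h0 h1 h2

/-- At Γ (`x = y = 0`) the antibonding energy is `0` for `Δ ≥ 0` (roots `0, −Δ, −Δ`). [folklore] -/
theorem abBand_Gamma {Δ : ℝ} (hΔ : 0 ≤ Δ) (tpd tpp c : ℝ) : abBand Δ tpd tpp c 0 0 = 0 := by
  apply le_antisymm
  · -- every root r satisfies r (Δ + r)² = 0
    have hroot := charCubic_abBand Δ tpd tpp c 0 0
    set r := abBand Δ tpd tpp c 0 0
    have hr : r * (Δ + r) ^ 2 = 0 := by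
      have : charCubic Δ tpd tpp c 0 0 r = r * (Δ + r) ^ 2 := by unfold charCubic; ring
      rw [← this]; exact hroot
    rcases mul_eq_zero.mp hr with h | h
    · exact h.le
    · have : Δ + r = 0 := pow_eq_zero_iff (two_ne_zero) |>.mp h
      linarith
  · apply le_abBand_of_charCubic_nonpos
    unfold charCubic
    simp

/-- On the Γ–X axis (`y = 0`, `t_pp′ = 0`) the secular function factorises:
`charCubic = (Δ + ε)(ε(Δ + ε) − 4t_pd²x)`, independent of `t_pp`. [folklore] -/
theorem charCubic_axis (Δ tpd tpp x ε : ℝ) :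
    charCubic Δ tpd tpp 0 x 0 ε = (Δ + ε) * (ε * (Δ + ε) - 4 * tpd ^ 2 * x) := by
  unfold charCubic
  ring

/-- The closed-form axis dispersion `g(x) = (−Δ + √(Δ² + 16t_pd²x))/2`. [folklore] -/
def axisBand (Δ tpd x : ℝ) : ℝ := (-Δ + Real.sqrt (Δ ^ 2 + 16 * tpd ^ 2 * x)) / 2

/-- `g(x) ≥ 0` for `x ≥ 0`. [folklore] -/
theorem axisBand_nonneg (Δ tpd : ℝ) {x : ℝ} (hx : 0 ≤ x) : 0 ≤ axisBand Δ tpd x := by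
  unfold axisBand
  have h : |Δ| ≤ Real.sqrt (Δ ^ 2 + 16 * tpd ^ 2 * x) := abs_le_sqrt_sq_add (by positivity)
  have := le_abs_self Δ
  linarith

/-- `g(x)` solves the axis secular quadratic: `g(g + Δ) = 4t_pd²x` (`x ≥ 0`). [folklore] -/
theorem axisBand_secular (Δ tpd : ℝ) {x : ℝ} (hx : 0 ≤ x) :
    axisBand Δ tpd x * (axisBand Δ tpd x + Δ) = 4 * tpd ^ 2 * x := by
  unfold axisBand
  have hs : Real.sqrt (Δ ^ 2 + 16 * tpd ^ 2 * x) ^ 2 = Δ ^ 2 + 16 * tpd ^ 2 * x :=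
    Real.sq_sqrt (by positivity)
  nlinarith [hs]

/-- THE AXIS BAND: for `Δ ≥ 0`, `x ≥ 0` the antibonding energy on the Γ–X axis is the closed form
`(−Δ + √(Δ² + 16t_pd²x))/2`, for every `t_pp` (the oxygen–oxygen hopping does not enter on the axis).
[folklore] -/
theorem abBand_axis {Δ : ℝ} (hΔ : 0 ≤ Δ) (tpd tpp : ℝ) {x : ℝ} (hx : 0 ≤ x) :
    abBand Δ tpd tpp 0 x 0 = axisBand Δ tpd x := by
  have hg0 := axisBand_nonneg Δ tpd hx
  have hsec := axisBand_secular Δ tpd hx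
  apply le_antisymm
  · have hroot := charCubic_abBand Δ tpd tpp 0 x 0
    set r := abBand Δ tpd tpp 0 x 0
    rw [charCubic_axis] at hroot
    rcases mul_eq_zero.mp hroot with h | h
    · have : r = -Δ := by linarith
      linarith
    · exact le_of_quadratic_root hg0 (by linarith) hsec (by linarith)
  · apply le_abBand_of_charCubic_nonpos
    rw [charCubic_axis]
    have : axisBand Δ tpd x * (Δ + axisBand Δ tpd x) - 4 * tpd ^ 2 * x = 0 := by linarith [hsec]
    rw [this, mul_zero]

/-- At X (`x = 1`, `y = 0`, `t_pp′ = 0`) the antibonding energy is `EmeryBlochBand.abX`. [folklore] -/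
theorem abBand_X {Δ : ℝ} (hΔ : 0 ≤ Δ) (tpd tpp : ℝ) : abBand Δ tpd tpp 0 1 0 = abX Δ tpd := by
  rw [abBand_axis hΔ tpd tpp zero_le_one]
  unfold axisBand abX
  ring_nf

end Summit.Ventures.CertifiedManyBodySolver.Downfold.Emery
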